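import Literature.Geometry.Kaehler.ComplexTorusAnalyticClassesHodgePP
import Literature.Geometry.Kaehler.ComplexTorusAnalyticClassesProducts
import Literature.Geometry.Kaehler.ComplexTorusAnalyticClassesLowDimension
import Literature.Geometry.Kaehler.ComplexTorusHodgeClassesProductHodgeGroupComplexPoints
import Literature.Geometry.Kaehler.ComplexTorusHodgeGroupSymplecticGramLieSimple
import Literature.Geometry.Kaehler.ComplexTorusHodgeGroupProductHodgeGeneralFactor
import HarnessLib

/-!
# The Hodge `(p,p)`-conjecture in cycle form is stable under products with independent Hodge groups:
# `A•(X₁) = B•(X₁)`, `A•(X₂) = B•(X₂)`, `Hg(X₁ × X₂) = Hg(X₁) × Hg(X₂)` ⟹ `A•(X₁ × X₂) = B•(X₁ × X₂)`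

Layer `Literature/Geometry/Kaehler`, namespace `Literature.Geometry.Kaehler.ComplexTorus`; lane
`lit-hodgefound`, seat p07 (generation 35, file 6), programme «consequences of `D•(X) ⊆ A•(X)` and the
functoriality of `A•(X)`». The tree knows (Moonen–Zarhin (3.1), Imai):
`Hg(X₁ × X₂) = Hg(X₁) × Hg(X₂)` (read on real points, on complex points, or as finite index) forces
`B^p(X₁ × X₂) = Σ_{a+b=p} B^a(X₁) ⊗ B^b(X₂)` — no exceptional Hodge classes on the product
(`hodgeClasses_prod_eq_span_cross_of_prod_le_hodgeGroup`), and it transfers `D = B` to the product. Here the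
same transfer is made for the ANALYTIC classes `Aᵖ` (the `ℚ`-span of the fundamental classes of the closed
analytic subsets of codimension `p`, `ComplexTorusAnalyticClasses.lean`): cross products of analytic classes are
analytic (`coe_crossProduct_comp_mem_analyticClasses`, `[Z₁] × [Z₂] = [Z₁ × Z₂]`), so when every Hodge class of
each factor is analytic, every Hodge class of `X₁ × X₂` is analytic. This is the standard reduction of the
Hodge conjecture for a product to its factors in the absence of exceptional classes (e.g. Gordon's survey,
Thm. 7.5–7.6; Moonen–Zarhin §3), now with `A` in place of `D` — strictly more: `D ⊆ A` on abelian varieties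
(`IsAbelianVariety.divisorClasses_le_analyticClasses`) and `D ≠ A` already for self-products of CM elliptic
curves.

* §1 **The transfer** for the Euclidean product torus `prodPeriodL2 Φ₁ Φ₂` of two complex tori (any pair):
  `analyticClasses_prod_eq_hodgeClasses_of_prod_le_hodgeGroup` (hypothesis on real points,
  `Hg(X₁)(ℝ) × Hg(X₂)(ℝ) ⊆ Hg(X₁ × X₂)(ℝ)`), `…_of_hodgeGroup_prod_eq`, `…_of_hodgeGroupC_prod_eq` (complex
  points), `…_of_relIndex_ne_zero` (Imai's finite index).
* §2 **Two unconditional families** (the Hodge-group input from the tree): a Hodge-general polarised abelian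
  variety `X₁` (`Hg(X₁) = Sp`, where `A• = B• = ℚ[θ]`, `ComplexTorusAnalyticClassesHodgePP`) times a torus `X₂`
  satisfying `A•(X₂) = B•(X₂)` whose Hodge group is solvable (Gordon's lemma,
  `IsRiemannForm.analyticClasses_prod_eq_hodgeClasses_of_hodgeGroup_eq_spGroup_of_isSolvable`) or of dimension
  `< g₁(2g₁+1)` (`…_of_zdim_lt`); in particular `X₁ × T` for every one-dimensional torus `T` when `g₁ ≥ 2`
  (`…_prod_eq_hodgeClasses_of_hodgeGroup_eq_spGroup_of_finrank_eq_one`).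

Theorems only; no definitions, no named facts.

## References

* [MoonenZarhin1999LowDim] B. Moonen, Yu. Zarhin, *Hodge classes on abelian varieties of low dimension*,
  Math. Ann. 315 (1999) 711–733, §3 (3.1).
* [Imai1976HodgeGroups] H. Imai, *On the Hodge groups of some abelian varieties*, Kodai Math. Sem. Rep. 27
  (1976) 367–372, §2.
* [Gordon1999HodgeAVSurvey] B. B. Gordon, *A survey of the Hodge conjecture for abelian varieties*, Appendix B
  in J. D. Lewis, *A Survey of the Hodge Conjecture*, 2nd ed. (1999), Thm. 7.5 and Thm. 7.6.2.
* [Lange2023AbelianVarietiesComplex] H. Lange, *Abelian Varieties over the Complex Numbers*, Springer 2023,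
  §7.3.1 (pp. 335–337).
* [Fulton1998] W. Fulton, *Intersection Theory*, 2nd ed., Springer 1998, §1.10 Prop. 1.10.
-/

noncomputable section

open scoped Manifold Matrix
open Set Function Module WithLp

universe u

namespace Literature.Geometry.Kaehler

namespace ComplexTorus

/-! ### §1 The transfer `A = B` from the factors to the product -/

section Transfer

variable {ι₁ ι₂ : Type*} [Fintype ι₁] [Fintype ι₂] [DecidableEq ι₁] [DecidableEq ι₂]
  {E₁ : Type u} [NormedAddCommGroup E₁] [InnerProductSpace ℂ E₁] [FiniteDimensional ℂ E₁]
  [MeasurableSpace E₁] [BorelSpace E₁]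
  {E₂ : Type u} [NormedAddCommGroup E₂] [InnerProductSpace ℂ E₂] [FiniteDimensional ℂ E₂]
  [MeasurableSpace E₂] [BorelSpace E₂]
  (Φ₁ : (ι₁ → ℝ) ≃L[ℝ] E₁) (Φ₂ : (ι₂ → ℝ) ≃L[ℝ] E₂) {n₁ n₂ : ℕ} (e₁ : Fin n₁ ≃ ι₁) (e₂ : Fin n₂ ≃ ι₂)

/-- **`A•(X₁) = B•(X₁)`, `A•(X₂) = B•(X₂)` and `Hg(X₁)(ℝ) × Hg(X₂)(ℝ) ⊆ Hg(X₁ × X₂)(ℝ)` ⟹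
`A•(X₁ × X₂) = B•(X₁ × X₂)`** (Euclidean product torus; every pair of complex tori). Under the Hodge-group
hypothesis the Hodge classes of `X₁ × X₂` are spanned by the cross products `pr₁^*γ ∧ pr₂^*δ` of Hodge classes
of the factors (no exceptional classes, `hodgeClasses_prod_eq_span_cross_of_prod_le_hodgeGroup`); these are
analytic by hypothesis, and cross products of analytic classes are analytic
(`coe_crossProduct_comp_mem_analyticClasses`). [cite: MoonenZarhin1999LowDim, §3 (3.1)]
[cite: Gordon1999HodgeAVSurvey, Thm. 7.5] [cite: Fulton1998, §1.10 Prop. 1.10] -/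
theorem analyticClasses_prod_eq_hodgeClasses_of_prod_le_hodgeGroup
    (hHg : ((hodgeGroup Φ₁).prod (hodgeGroup Φ₂)).map (blockDiag ι₁ ι₂) ≤ hodgeGroup (prodPeriod Φ₁ Φ₂))
    (h₁ : ∀ a, analyticClasses Φ₁ e₁ a = hodgeClasses Φ₁ a)
    (h₂ : ∀ b, analyticClasses Φ₂ e₂ b = hodgeClasses Φ₂ b) (p : ℕ) :
    analyticClasses (prodPeriodL2 Φ₁ Φ₂) (sumEnum e₁ e₂) p = hodgeClasses (prodPeriodL2 Φ₁ Φ₂) p := by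
  refine le_antisymm (analyticClasses_le_hodgeClasses _ _ p) fun β hβ ↦ ?_
  set P := (WithLp.prodContinuousLinearEquiv 2 ℝ E₁ E₂ : WithLp 2 (E₁ × E₂) →L[ℝ] E₁ × E₂) with hP
  -- `β` read on the sup-normed product torus is a Hodge class there, hence a sum of cross products
  have hβ' : β.compContinuousLinearMap (realRep (prodPeriod Φ₁ Φ₂) (prodPeriodL2 Φ₁ Φ₂) 1) ∈
      hodgeClasses (prodPeriod Φ₁ Φ₂) p :=
    comp_realRep_mem_hodgeClassesIn (prodPeriod Φ₁ Φ₂) (prodPeriodL2 Φ₁ Φ₂) 1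
      ((isIsogeny_one_prodPeriod_prodPeriodL2 Φ₁ Φ₂).realRep_smul (prodPeriod Φ₁ Φ₂) (prodPeriodL2 Φ₁ Φ₂)) hβ
  rw [hodgeClasses_prod_eq_span_cross_of_prod_le_hodgeGroup Φ₁ Φ₂ hHg p] at hβ'
  -- `β = (β ∘ P⁻¹) ∘ P`
  have hback : (β.compContinuousLinearMap (realRep (prodPeriod Φ₁ Φ₂) (prodPeriodL2 Φ₁ Φ₂) 1)).compContinuousLinearMap
      P = β := by
    rw [realRep_one_prodPeriod_prodPeriodL2]
    ext v
    simp only [ContinuousAlternatingMap.compContinuousLinearMap_apply, Function.comp_def, hP,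
      ContinuousLinearEquiv.coe_coe, ContinuousLinearEquiv.symm_apply_apply]
  rw [← hback]
  -- `(· ∘ P)` carries the span of the cross products into `Aᵖ(X₁ × X₂)`
  let L : ((E₁ × E₂) [⋀^Fin (2 * p)]→L[ℝ] ℂ) →ₗ[ℚ] (WithLp 2 (E₁ × E₂) [⋀^Fin (2 * p)]→L[ℝ] ℂ) :=
    { toFun := fun γ ↦ γ.compContinuousLinearMap P
      map_add' := fun γ δ ↦ by ext v; rfl
      map_smul' := fun c γ ↦ by ext v; rfl }
  have hle : Submodule.span ℚ
      {x | ∃ (a b : ℕ) (h : 2 * a + 2 * b = 2 * p) (γ : E₁ [⋀^Fin (2 * a)]→L[ℝ] ℂ) (δ : E₂ [⋀^Fin (2 * b)]→L[ℝ] ℂ),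
        γ ∈ hodgeClasses Φ₁ a ∧ δ ∈ hodgeClasses Φ₂ b ∧
          x = ((γ.compContinuousLinearMap (ContinuousLinearMap.fst ℝ E₁ E₂)).wedge
            (δ.compContinuousLinearMap (ContinuousLinearMap.snd ℝ E₁ E₂))).domDomCongr (finCongr h)} ≤
      (analyticClasses (prodPeriodL2 Φ₁ Φ₂) (sumEnum e₁ e₂) p).comap L := by
    refine Submodule.span_le.2 ?_
    rintro _ ⟨a, b, h, γ, δ, hγ, hδ, rfl⟩
    obtain rfl : p = a + b := by omega
    rw [← h₁ a] at hγ
    rw [← h₂ b] at hδ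
    have hx := coe_crossProduct_comp_mem_analyticClasses Φ₁ Φ₂ e₁ e₂ h
      (α := ⟨γ, analyticClasses_le_rationalForms Φ₁ e₁ a hγ⟩)
      (β := ⟨δ, analyticClasses_le_rationalForms Φ₂ e₂ b hδ⟩) hγ hδ
    rw [coe_crossProduct] at hx
    exact hx
  exact hle hβ'

/-- The transfer under real equality `Hg(X₁ × X₂)(ℝ) = Hg(X₁)(ℝ) × Hg(X₂)(ℝ)`.
[cite: MoonenZarhin1999LowDim, §3 (3.1)] [cite: Gordon1999HodgeAVSurvey, Thm. 7.5] -/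
theorem analyticClasses_prod_eq_hodgeClasses_of_hodgeGroup_prod_eq
    (hHg : hodgeGroup (prodPeriod Φ₁ Φ₂) = ((hodgeGroup Φ₁).prod (hodgeGroup Φ₂)).map (blockDiag ι₁ ι₂))
    (h₁ : ∀ a, analyticClasses Φ₁ e₁ a = hodgeClasses Φ₁ a)
    (h₂ : ∀ b, analyticClasses Φ₂ e₂ b = hodgeClasses Φ₂ b) (p : ℕ) :
    analyticClasses (prodPeriodL2 Φ₁ Φ₂) (sumEnum e₁ e₂) p = hodgeClasses (prodPeriodL2 Φ₁ Φ₂) p :=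
  analyticClasses_prod_eq_hodgeClasses_of_prod_le_hodgeGroup Φ₁ Φ₂ e₁ e₂ hHg.ge h₁ h₂ p

/-- **The transfer under `Hg(X₁ × X₂)(ℂ) = Hg(X₁)(ℂ) × Hg(X₂)(ℂ)`** (complex points; every pair of tori).
[cite: MoonenZarhin1999LowDim, §3 (3.1)] [cite: Imai1976HodgeGroups, §2] -/
theorem analyticClasses_prod_eq_hodgeClasses_of_hodgeGroupC_prod_eq
    (hHg : hodgeGroupC (prodPeriod Φ₁ Φ₂) = blockDiagProd (hodgeGroupC Φ₁) (hodgeGroupC Φ₂))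
    (h₁ : ∀ a, analyticClasses Φ₁ e₁ a = hodgeClasses Φ₁ a)
    (h₂ : ∀ b, analyticClasses Φ₂ e₂ b = hodgeClasses Φ₂ b) (p : ℕ) :
    analyticClasses (prodPeriodL2 Φ₁ Φ₂) (sumEnum e₁ e₂) p = hodgeClasses (prodPeriodL2 Φ₁ Φ₂) p :=
  analyticClasses_prod_eq_hodgeClasses_of_prod_le_hodgeGroup Φ₁ Φ₂ e₁ e₂
    (prod_le_hodgeGroup_of_hodgeGroupC_prod_eq hHg) h₁ h₂ p

/-- **Imai's shape: finite index of `Hg(X₁ × X₂)(ℂ)` in `Hg(X₁)(ℂ) × Hg(X₂)(ℂ)` and `A = B` on both factors give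
`A = B` on `X₁ × X₂`.** [cite: Imai1976HodgeGroups, §2 (Theorem)] [cite: MoonenZarhin1999LowDim, §3 (3.1)] -/
theorem analyticClasses_prod_eq_hodgeClasses_of_relIndex_ne_zero
    (hHg : (hodgeGroupC (prodPeriod Φ₁ Φ₂)).relIndex (blockDiagProd (hodgeGroupC Φ₁) (hodgeGroupC Φ₂)) ≠ 0)
    (h₁ : ∀ a, analyticClasses Φ₁ e₁ a = hodgeClasses Φ₁ a)
    (h₂ : ∀ b, analyticClasses Φ₂ e₂ b = hodgeClasses Φ₂ b) (p : ℕ) :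
    analyticClasses (prodPeriodL2 Φ₁ Φ₂) (sumEnum e₁ e₂) p = hodgeClasses (prodPeriodL2 Φ₁ Φ₂) p :=
  analyticClasses_prod_eq_hodgeClasses_of_prod_le_hodgeGroup Φ₁ Φ₂ e₁ e₂
    (prod_le_hodgeGroup_of_relIndex_ne_zero hHg) h₁ h₂ p

end Transfer

/-! ### §2 Hodge-general `X₁` times a factor with small or solvable Hodge group -/

section HodgeGeneral

variable {ι₁ ι₂ : Type*} [Fintype ι₁] [Fintype ι₂] [DecidableEq ι₁] [DecidableEq ι₂] [Nonempty ι₁]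
  {E₁ : Type u} [NormedAddCommGroup E₁] [InnerProductSpace ℂ E₁] [FiniteDimensional ℂ E₁]
  [MeasurableSpace E₁] [BorelSpace E₁]
  {E₂ : Type u} [NormedAddCommGroup E₂] [InnerProductSpace ℂ E₂] [FiniteDimensional ℂ E₂]
  [MeasurableSpace E₂] [BorelSpace E₂]
  (Φ₁ : (ι₁ → ℝ) ≃L[ℝ] E₁) (Φ₂ : (ι₂ → ℝ) ≃L[ℝ] E₂) {n₁ n₂ : ℕ} (e₁ : Fin n₁ ≃ ι₁) (e₂ : Fin n₂ ≃ ι₂)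
  {η₁ : E₁ [⋀^Fin 2]→L[ℝ] ℝ}

/-- **Gordon's lemma route: a Hodge-general polarised abelian variety `X₁` (`Hg(X₁) = Sp(V₁, E₁)`) times a
complex torus `X₂` with solvable Hodge group and `A•(X₂) = B•(X₂)` satisfies `A•(X₁ × X₂) = B•(X₁ × X₂)`** —
`Hg(X₁ × X₂)` splits (`IsRiemannForm.hodgeGroupC_prod_eq_blockDiagProd_of_isSolvable`) and `A•(X₁) = B•(X₁) =
ℚ[θ]` (Mattuck, `IsRiemannForm.analyticClasses_eq_hodgeClasses_of_hodgeGroup_eq_spGroup`).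
[cite: Gordon1999HodgeAVSurvey, Thm. 7.5 and Thm. 7.6.2] [cite: MoonenZarhin1999LowDim, §3 Theorem (2)]
[cite: Lange2023AbelianVarietiesComplex, §7.3.1 Thm. 7.3.1 and Prop. 7.3.2] -/
theorem IsRiemannForm.analyticClasses_prod_eq_hodgeClasses_of_hodgeGroup_eq_spGroup_of_isSolvable
    (hη₁ : IsRiemannForm Φ₁ η₁) (hHg₁ : hodgeGroup Φ₁ = spGroup Φ₁ η₁) (hsolv : IsSolvable ↥(hodgeGroupC Φ₂))
    (h₂ : ∀ b, analyticClasses Φ₂ e₂ b = hodgeClasses Φ₂ b) (p : ℕ) :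
    analyticClasses (prodPeriodL2 Φ₁ Φ₂) (sumEnum e₁ e₂) p = hodgeClasses (prodPeriodL2 Φ₁ Φ₂) p :=
  analyticClasses_prod_eq_hodgeClasses_of_hodgeGroupC_prod_eq Φ₁ Φ₂ e₁ e₂
    (hη₁.hodgeGroupC_prod_eq_blockDiagProd_of_isSolvable Φ₂ hHg₁ hsolv)
    (hη₁.analyticClasses_eq_hodgeClasses_of_hodgeGroup_eq_spGroup Φ₁ e₁ hHg₁) h₂ p

/-- **Dimension route: a Hodge-general polarised `X₁` times a torus `X₂` with `dim Hg(X₂) < g₁(2g₁ + 1)` and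
`A•(X₂) = B•(X₂)` satisfies `A•(X₁ × X₂) = B•(X₁ × X₂)`.**
[cite: Gordon1999HodgeAVSurvey, Thm. 7.5] [cite: MoonenZarhin1999LowDim, §3 (3.1)]
[cite: Lange2023AbelianVarietiesComplex, §7.3.1 Thm. 7.3.1] -/
theorem IsRiemannForm.analyticClasses_prod_eq_hodgeClasses_of_hodgeGroup_eq_spGroup_of_zdim_lt
    (hη₁ : IsRiemannForm Φ₁ η₁) (hHg₁ : hodgeGroup Φ₁ = spGroup Φ₁ η₁)
    (hlt : (isZConnected_map_toGL_hodgeGroupC Φ₂).zdim < finrank ℂ E₁ * (2 * finrank ℂ E₁ + 1))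
    (h₂ : ∀ b, analyticClasses Φ₂ e₂ b = hodgeClasses Φ₂ b) (p : ℕ) :
    analyticClasses (prodPeriodL2 Φ₁ Φ₂) (sumEnum e₁ e₂) p = hodgeClasses (prodPeriodL2 Φ₁ Φ₂) p :=
  analyticClasses_prod_eq_hodgeClasses_of_hodgeGroupC_prod_eq Φ₁ Φ₂ e₁ e₂
    (hη₁.hodgeGroupC_prod_eq_blockDiagProd_of_zdim_lt Φ₂ hHg₁ hlt)
    (hη₁.analyticClasses_eq_hodgeClasses_of_hodgeGroup_eq_spGroup Φ₁ e₁ hHg₁) h₂ p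

/-- **A Hodge-general polarised abelian variety of dimension `g₁ ≥ 2` times ANY one-dimensional complex torus `T`
satisfies `A•(X₁ × T) = B•(X₁ × T)`**: `dim Hg(T) ≤ 3 < g₁(2g₁ + 1)` (dimension route) and `A•(T) = B•(T)`
(`analyticClasses_eq_hodgeClasses_of_finrank_le_one`). (For `g₁ = 1` the product is an abelian surface,
`analyticClasses_prodPeriodL2_eq_hodgeClasses_of_finrank_eq_one`.) [cite: MoonenZarhin1999LowDim, §3 (3.1)]
[cite: Imai1976HodgeGroups, §2] [cite: Lange2023AbelianVarietiesComplex, §7.3.1 Thm. 7.3.1] -/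
theorem IsRiemannForm.analyticClasses_prod_eq_hodgeClasses_of_hodgeGroup_eq_spGroup_of_finrank_eq_one
    (hη₁ : IsRiemannForm Φ₁ η₁) (hHg₁ : hodgeGroup Φ₁ = spGroup Φ₁ η₁) (hg₁ : 2 ≤ finrank ℂ E₁)
    (hg₂ : finrank ℂ E₂ = 1) (p : ℕ) :
    analyticClasses (prodPeriodL2 Φ₁ Φ₂) (sumEnum e₁ e₂) p = hodgeClasses (prodPeriodL2 Φ₁ Φ₂) p := by
  have hn₂ : Fintype.card ι₂ = n₂ := by rw [← Fintype.card_congr e₂, Fintype.card_fin]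
  have h2 := finrank_complex_mul_two Φ₂ e₂
  have hcard : Fintype.card ι₂ = 2 := by omega
  refine hη₁.analyticClasses_prod_eq_hodgeClasses_of_hodgeGroup_eq_spGroup_of_zdim_lt Φ₁ Φ₂ e₁ e₂ hHg₁ ?_
    (analyticClasses_eq_hodgeClasses_of_finrank_le_one Φ₂ e₂ hg₂.le) p
  calc (isZConnected_map_toGL_hodgeGroupC Φ₂).zdim ≤ Fintype.card ι₂ ^ 2 - 1 := zdim_map_toGL_hodgeGroupC_le Φ₂
    _ = 3 := by rw [hcard]; norm_num
    _ < finrank ℂ E₁ * (2 * finrank ℂ E₁ + 1) := by nlinarith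

end HodgeGeneral

end ComplexTorus

end Literature.Geometry.Kaehler
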